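import Summits.RiemannHypothesis.RiemannHypothesis.Theses.RuelleBand
import Literature.NumberTheory.LFunctions.LandauOscillation
import Literature.Analysis.Complex.BoundedPowerSums
import HarnessLib.Audit

/-!
# Line `SketchIdeator1` (even Weil sector), engine part 1: the Landau transform of a bounded-below exponential sum

Crux `RuelleBand.ExactFirstBand` (stmt-RiemannHypothesis-2061), line SketchIdeator1, analytic half of the ONE-SIDED
power-sum lemma `stub_evenEngine`.  For a real exponential sum `F(x) = Σᵢ cᵢ e^{λᵢ x}` (`Σ‖cᵢ‖ < ∞`, `Re λᵢ ≤ R`,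
`(λᵢ)` locally finite, no `λᵢ` on the open positive real axis) with `F ≥ -M` on `x ≥ 0`, the transform
`𝓜(s) = ∫₁^∞ (F(log y) + M) y^{-s-1} dy` of the NON-NEGATIVE function `y ↦ F(log y) + M` equals
`Σᵢ cᵢ/(s-λᵢ) + M/s` for `Re s > R` and is holomorphic on all of `Re s > 0` by LANDAU'S THEOREM (tree, PROVED:
`Landau.integrableOn_of_differentiableOn_union_convex`): the right-hand side is holomorphic on a thin box around
the real segment `(0, R+2]` because no `λᵢ` is a positive real.  Main theorem `stub_evenEngine_transform`; the
pole-clearing half is `stub_evenEngine` in the sibling file.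
-/

set_option linter.dupNamespace false

noncomputable section

open Complex Filter Set MeasureTheory Metric
open scoped Real Topology

namespace Summit.RiemannHypothesis.RiemannHypothesis.Theorems.RuelleBandExactFirstBand

open Literature.NumberTheory.LFunctions
open Literature.Analysis.Complex

section Transform

variable {ι : Type} {c lam : ι → ℂ} {R M : ℝ}


/-- Norm of a term: `‖cᵢ e^{λᵢ x}‖ = ‖cᵢ‖ e^{(Re λᵢ) x}` for real `x`. [folklore] -/
theorem evenEngine_norm_term (i : ι) (x : ℝ) :
    ‖c i * cexp (lam i * x)‖ = ‖c i‖ * Real.exp ((lam i).re * x) := by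
  rw [norm_mul, Complex.norm_exp]
  congr 2
  simp [Complex.mul_re]

/-- On `0 ≤ x ≤ X` the terms are bounded by `‖cᵢ‖ e^{R X}` (`R ≥ 0`, `Re λᵢ ≤ R`). [folklore] -/
theorem evenEngine_norm_term_le (hR : ∀ i, (lam i).re ≤ R) (hR0 : 0 ≤ R) {X x : ℝ}
    (hx0 : 0 ≤ x) (hxX : x ≤ X) (i : ι) :
    ‖c i * cexp (lam i * x)‖ ≤ ‖c i‖ * Real.exp (R * X) := by
  rw [evenEngine_norm_term]
  refine mul_le_mul_of_nonneg_left (Real.exp_le_exp.2 ?_) (norm_nonneg _)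
  calc (lam i).re * x ≤ R * x := mul_le_mul_of_nonneg_right (hR i) hx0
    _ ≤ R * X := mul_le_mul_of_nonneg_left hxX hR0

/-- The norms of the terms are summable for `x ≥ 0`. [folklore] -/
theorem evenEngine_summable_norm (hc : Summable fun i ↦ ‖c i‖) (hR : ∀ i, (lam i).re ≤ R)
    (hR0 : 0 ≤ R) {x : ℝ} (hx : 0 ≤ x) :
    Summable fun i ↦ ‖c i * cexp (lam i * x)‖ :=
  Summable.of_nonneg_of_le (fun _ ↦ norm_nonneg _) (fun i ↦ evenEngine_norm_term_le hR hR0 hx le_rfl i)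
    (hc.mul_right _)

/-- `‖F(x)‖ ≤ (Σ ‖cᵢ‖) e^{R x}` for `x ≥ 0`. [folklore] -/
theorem evenEngine_norm_tsum_le (hc : Summable fun i ↦ ‖c i‖) (hR : ∀ i, (lam i).re ≤ R)
    (hR0 : 0 ≤ R) {x : ℝ} (hx : 0 ≤ x) :
    ‖∑' i, c i * cexp (lam i * x)‖ ≤ (∑' i, ‖c i‖) * Real.exp (R * x) := by
  calc ‖∑' i, c i * cexp (lam i * x)‖ ≤ ∑' i, ‖c i * cexp (lam i * x)‖ :=
        norm_tsum_le_tsum_norm (evenEngine_summable_norm hc hR hR0 hx)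
    _ ≤ ∑' i, ‖c i‖ * Real.exp (R * x) :=
        (evenEngine_summable_norm hc hR hR0 hx).tsum_le_tsum
          (fun i ↦ evenEngine_norm_term_le hR hR0 hx le_rfl i) (hc.mul_right _)
    _ = (∑' i, ‖c i‖) * Real.exp (R * x) := tsum_mul_right

/-- `F` is continuous on `[0, ∞)` (locally uniform convergence). [folklore] -/
theorem evenEngine_continuousOn (hc : Summable fun i ↦ ‖c i‖) (hR : ∀ i, (lam i).re ≤ R)
    (hR0 : 0 ≤ R) : ContinuousOn (fun x : ℝ ↦ ∑' i, c i * cexp (lam i * x)) (Ici 0) := by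
  intro x₀ hx₀
  have hcont : ContinuousOn (fun x : ℝ ↦ ∑' i, c i * cexp (lam i * x)) (Icc 0 (x₀ + 1)) :=
    continuousOn_tsum (fun i ↦ (by fun_prop : Continuous fun x : ℝ ↦ c i * cexp (lam i * x)).continuousOn)
      (hc.mul_right _) fun i x hx ↦ evenEngine_norm_term_le hR hR0 hx.1 hx.2 i
  have hmem : Icc 0 (x₀ + 1) ∈ 𝓝[Ici 0] x₀ := by
    refine mem_nhdsWithin.2 ⟨Iio (x₀ + 1), isOpen_Iio, by simp, fun x hx ↦ ⟨hx.2, le_of_lt hx.1⟩⟩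
  exact (hcont.continuousWithinAt ⟨hx₀, by linarith⟩).mono_of_mem_nhdsWithin hmem


/-- `g` is continuous (hence measurable). [folklore] -/
theorem evenEngine_continuous_g (hc : Summable fun i ↦ ‖c i‖) (hR : ∀ i, (lam i).re ≤ R)
    (hR0 : 0 ≤ R) :
    Continuous fun y : ℝ ↦
      (∑' i, c i * cexp (lam i * ((Real.log (max y 1) : ℝ) : ℂ))).re + M := by
  have hlog : Continuous fun y : ℝ ↦ Real.log (max y 1) :=
    (continuous_id.max continuous_const).log fun y ↦ by positivity
  exact (Complex.continuous_re.comp ((evenEngine_continuousOn hc hR hR0).comp_continuous hlog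
    fun y ↦ Real.log_nonneg (le_max_right _ _))).add continuous_const

/-- For `y > 1`: `max y 1 = y` and `log y ≥ 0`. [folklore] -/
theorem evenEngine_log_max {y : ℝ} (hy : 1 < y) : Real.log (max y 1) = Real.log y ∧ 0 ≤ Real.log y :=
  ⟨by rw [max_eq_left hy.le], Real.log_nonneg hy.le⟩

/-- `g ≥ 0` everywhere when `Re F ≥ -M` on `[0, ∞)` (`log (max y 1) ≥ 0`). [folklore] -/
theorem evenEngine_g_nonneg (hM : ∀ x : ℝ, 0 ≤ x → -M ≤ (∑' i, c i * cexp (lam i * x)).re) (y : ℝ) :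
    0 ≤ (∑' i, c i * cexp (lam i * ((Real.log (max y 1) : ℝ) : ℂ))).re + M := by
  linarith [hM (Real.log (max y 1)) (Real.log_nonneg (le_max_right _ _))]

/-- Growth of `g`: `|g(y)| ≤ (Σ‖cᵢ‖) y^R + |M|` for `y > 1`. [folklore] -/
theorem evenEngine_abs_g_le (hc : Summable fun i ↦ ‖c i‖) (hR : ∀ i, (lam i).re ≤ R)
    (hR0 : 0 ≤ R) {y : ℝ} (hy : 1 < y) :
    |(∑' i, c i * cexp (lam i * ((Real.log (max y 1) : ℝ) : ℂ))).re + M| ≤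
      (∑' i, ‖c i‖) * y ^ R + |M| := by
  have hy0 : 0 < y := zero_lt_one.trans hy
  rw [(evenEngine_log_max hy).1]
  have h1 : |(∑' i, c i * cexp (lam i * ((Real.log y : ℝ) : ℂ))).re| ≤ (∑' i, ‖c i‖) * y ^ R := by
    refine (Complex.abs_re_le_norm _).trans ?_
    have h := evenEngine_norm_tsum_le hc hR hR0 (evenEngine_log_max hy).2 (c := c) (lam := lam)
    rwa [Real.rpow_def_of_pos hy0, mul_comm (Real.log y)]
  exact (abs_add_le _ _).trans (add_le_add h1 le_rfl)

/-- Absolute convergence of the transform at every `σ₁ > R`: `∫₁^∞ |g| y^{-(σ₁+1)} dy < ∞`. [folklore] -/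
theorem evenEngine_hint (hc : Summable fun i ↦ ‖c i‖) (hR : ∀ i, (lam i).re ≤ R) (hR0 : 0 ≤ R)
    {σ₁ : ℝ} (hσ : R < σ₁) :
    IntegrableOn (fun y : ℝ ↦
      ((∑' i, c i * cexp (lam i * ((Real.log (max y 1) : ℝ) : ℂ))).re + M) * y ^ (-(σ₁ + 1)))
      (Ioi 1) := by
  set C : ℝ := (∑' i, ‖c i‖) + |M| with hC
  have hdom : IntegrableOn (fun y : ℝ ↦ C * y ^ (R - σ₁ - 1)) (Ioi 1) :=
    (integrableOn_Ioi_rpow_of_lt (by linarith) zero_lt_one).const_mul C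
  refine Integrable.mono' hdom ?_ ?_
  · refine ContinuousOn.aestronglyMeasurable (fun y hy ↦ ?_) measurableSet_Ioi
    have hy0 : 0 < y := zero_lt_one.trans hy
    exact (((evenEngine_continuous_g hc hR hR0 (M := M)).continuousAt).mul
      (Real.continuousAt_rpow_const _ _ (Or.inl hy0.ne'))).continuousWithinAt
  · rw [ae_restrict_iff' measurableSet_Ioi]
    refine Eventually.of_forall fun y hy ↦ ?_
    have hy0 : 0 < y := zero_lt_one.trans hy
    have hy1 : 1 ≤ y := le_of_lt hy
    rw [Real.norm_eq_abs, abs_mul, abs_of_pos (Real.rpow_pos_of_pos hy0 _)]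
    have hg := evenEngine_abs_g_le hc hR hR0 hy (M := M)
    have hpow : y ^ R * y ^ (-(σ₁ + 1)) = y ^ (R - σ₁ - 1) := by
      rw [← Real.rpow_add hy0]; ring_nf
    have hle : y ^ (-(σ₁ + 1)) ≤ y ^ (R - σ₁ - 1) :=
      Real.rpow_le_rpow_of_exponent_le hy1 (by linarith)
    have h2 : 0 ≤ y ^ (-(σ₁ + 1)) := Real.rpow_nonneg hy0.le _
    calc |(∑' i, c i * cexp (lam i * ((Real.log (max y 1) : ℝ) : ℂ))).re + M| * y ^ (-(σ₁ + 1))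
        ≤ ((∑' i, ‖c i‖) * y ^ R + |M|) * y ^ (-(σ₁ + 1)) :=
          mul_le_mul_of_nonneg_right hg h2
      _ = (∑' i, ‖c i‖) * (y ^ R * y ^ (-(σ₁ + 1))) + |M| * y ^ (-(σ₁ + 1)) := by ring
      _ ≤ (∑' i, ‖c i‖) * y ^ (R - σ₁ - 1) + |M| * y ^ (R - σ₁ - 1) := by
          rw [hpow]
          exact add_le_add le_rfl (mul_le_mul_of_nonneg_left hle (abs_nonneg M))
      _ = C * y ^ (R - σ₁ - 1) := by rw [hC]; ring


/-- For `y > 1` the integrand of the transform is `Σᵢ cᵢ y^{λᵢ-(s+1)} + M y^{-(s+1)}`. [folklore] -/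
theorem evenEngine_integrand_eq
    (hreal : ∀ x : ℝ, 0 ≤ x → (∑' i, c i * cexp (lam i * x)).im = 0) {y : ℝ} (hy : 1 < y) (s : ℂ) :
    ((((∑' i, c i * cexp (lam i * ((Real.log (max y 1) : ℝ) : ℂ))).re + M : ℝ)) : ℂ) *
        (y : ℂ) ^ (-(s + 1)) =
      (∑' i, c i * (y : ℂ) ^ (lam i - (s + 1))) + (M : ℂ) * (y : ℂ) ^ (-(s + 1)) := by
  have hy0 : 0 < y := zero_lt_one.trans hy
  have hyC : (y : ℂ) ≠ 0 := by exact_mod_cast hy0.ne'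
  rw [(evenEngine_log_max hy).1]
  have hF : ((((∑' i, c i * cexp (lam i * ((Real.log y : ℝ) : ℂ))).re : ℝ)) : ℂ) =
      ∑' i, c i * cexp (lam i * ((Real.log y : ℝ) : ℂ)) := by
    apply Complex.ext
    · simp
    · rw [ofReal_im, hreal _ (evenEngine_log_max hy).2]
  have hterm : ∀ i, c i * cexp (lam i * ((Real.log y : ℝ) : ℂ)) * (y : ℂ) ^ (-(s + 1)) =
      c i * (y : ℂ) ^ (lam i - (s + 1)) := by
    intro i
    have h1 : cexp (lam i * ((Real.log y : ℝ) : ℂ)) = (y : ℂ) ^ (lam i) := by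
      rw [Complex.ofReal_log hy0.le, Complex.cpow_def_of_ne_zero hyC, mul_comm]
    rw [mul_assoc, h1, ← Complex.cpow_add _ _ hyC, sub_eq_add_neg]
  push_cast
  rw [hF, add_mul, ← tsum_mul_right]
  exact congrArg (· + (M : ℂ) * (y : ℂ) ^ (-(s + 1))) (tsum_congr hterm)

/-- `∫₁^∞ t^a dt = -1/(a+1)` for `Re a < -1` (complex power). [folklore] -/
theorem evenEngine_integral_cpow {a : ℂ} (ha : a.re < -1) :
    ∫ t : ℝ in Ioi 1, (t : ℂ) ^ a = -1 / (a + 1) := by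
  rw [integral_Ioi_cpow_of_lt ha zero_lt_one, Complex.ofReal_one, Complex.one_cpow]

/-- **The transform on `Re s > R`**: `HasSum (cᵢ/(s-λᵢ)) (𝓜(s) - M/s)`, `𝓜 = Landau.mellinIoi g`,
`g(y) = Re F(log (max y 1)) + M` (termwise integrals, dominated interchange, `∫₁^∞ M y^{-s-1} = M/s`). [folklore] -/
theorem evenEngine_hasSum_transform [Countable ι] (hc : Summable fun i ↦ ‖c i‖) (hR : ∀ i, (lam i).re ≤ R)
    (hR0 : 0 ≤ R) (hreal : ∀ x : ℝ, 0 ≤ x → (∑' i, c i * cexp (lam i * x)).im = 0)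
    {s : ℂ} (hs : R < s.re) :
    HasSum (fun i ↦ c i / (s - lam i))
      (Landau.mellinIoi (fun y : ℝ ↦ (∑' i, c i * cexp (lam i * ((Real.log (max y 1) : ℝ) : ℂ))).re + M) s
        - M / s) := by
  classical
  have hs0 : 0 < s.re := hR0.trans_lt hs
  have hsne : s ≠ 0 := fun h ↦ by rw [h, zero_re] at hs0; exact lt_irrefl _ hs0
  -- the terms `G i`
  set G : ι → ℝ → ℂ := fun i y ↦ c i * (y : ℂ) ^ (lam i - (s + 1)) with hG
  have hGre : ∀ i, (lam i - (s + 1)).re < -1 := fun i ↦ by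
    simp only [sub_re, add_re, one_re]; linarith [hR i]
  have hGint : ∀ i, Integrable (G i) (volume.restrict (Ioi 1)) := fun i ↦
    (integrableOn_Ioi_cpow_of_lt (hGre i) zero_lt_one).const_mul (c i)
  have hGval : ∀ i, ∫ y in Ioi (1 : ℝ), G i y = c i / (s - lam i) := by
    intro i
    have hne : s - lam i ≠ 0 := fun h ↦ by
      have h' := congrArg re h
      simp only [sub_re, zero_re] at h'
      linarith [hR i]
    have hne' : lam i - (s + 1) + 1 ≠ 0 := by
      rw [show lam i - (s + 1) + 1 = -(s - lam i) by ring]; exact neg_ne_zero.2 hne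
    simp only [hG]
    rw [integral_const_mul, evenEngine_integral_cpow (hGre i)]
    field_simp
    ring
  have hGnorm : ∀ i, ∫ y in Ioi (1 : ℝ), ‖G i y‖ = ‖c i‖ * (1 / (s.re - (lam i).re)) := by
    intro i
    have h1 : ∫ y in Ioi (1 : ℝ), ‖G i y‖ = ∫ y in Ioi (1 : ℝ), ‖c i‖ * y ^ ((lam i).re - s.re - 1) := by
      refine setIntegral_congr_fun measurableSet_Ioi fun y hy ↦ ?_
      have hy0 : 0 < y := zero_lt_one.trans hy
      simp only [hG]
      rw [norm_mul, Complex.norm_cpow_eq_rpow_re_of_pos hy0]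
      congr 2
      simp only [sub_re, add_re, one_re]
      ring
    have hlt : (lam i).re - s.re - 1 < -1 := by linarith [hR i]
    rw [h1, integral_const_mul, integral_Ioi_rpow_of_lt hlt zero_lt_one, Real.one_rpow]
    congr 1
    rw [show (lam i).re - s.re - 1 + 1 = -(s.re - (lam i).re) by ring, div_neg, neg_div, neg_neg]
  have hGsum : Summable fun i ↦ ∫ y in Ioi (1 : ℝ), ‖G i y‖ := by
    refine Summable.of_nonneg_of_le (fun i ↦ integral_nonneg fun _ ↦ norm_nonneg _) (fun i ↦ ?_)
      (hc.mul_right (1 / (s.re - R)))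
    rw [hGnorm i]
    have h1 : 0 < s.re - R := by linarith
    have h2 : s.re - R ≤ s.re - (lam i).re := by linarith [hR i]
    exact mul_le_mul_of_nonneg_left (one_div_le_one_div_of_le h1 h2) (norm_nonneg _)
  have key := hasSum_integral_of_summable_integral_norm hGint hGsum
  simp only [hGval] at key
  -- the term `H`
  set H : ℝ → ℂ := fun y ↦ (M : ℂ) * (y : ℂ) ^ (-(s + 1)) with hH
  have hHre : (-(s + 1)).re < -1 := by simp only [neg_re, add_re, one_re]; linarith
  have hHint : Integrable H (volume.restrict (Ioi 1)) :=
    (integrableOn_Ioi_cpow_of_lt hHre zero_lt_one).const_mul (M : ℂ)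
  have hHval : ∫ y in Ioi (1 : ℝ), H y = M / s := by
    have hne' : -(s + 1) + 1 ≠ 0 := by rw [show -(s + 1) + 1 = -s by ring]; exact neg_ne_zero.2 hsne
    simp only [hH]
    rw [integral_const_mul, evenEngine_integral_cpow hHre]
    field_simp
    ring
  -- the integrand of the transform
  set g : ℝ → ℝ := fun y ↦ (∑' i, c i * cexp (lam i * ((Real.log (max y 1) : ℝ) : ℂ))).re + M with hg
  have hgm : Measurable g := (evenEngine_continuous_g hc hR hR0).measurable
  have hIint : Integrable (fun y : ℝ ↦ ((g y : ℝ) : ℂ) * (y : ℂ) ^ (-(s + 1)))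
      (volume.restrict (Ioi 1)) := by
    have hσ : R < (R + s.re) / 2 := by linarith
    have h := Landau.integrable_mellinIntegrand hgm (evenEngine_hint hc hR hR0 hσ) 0
      (s := s) (by show (R + s.re) / 2 < s.re; linarith)
    refine h.congr (Eventually.of_forall fun y ↦ ?_)
    simp [Landau.mellinIntegrand]
  have hpt : ∀ y ∈ Ioi (1 : ℝ), ((g y : ℝ) : ℂ) * (y : ℂ) ^ (-(s + 1)) = (∑' i, G i y) + H y :=
    fun y hy ↦ evenEngine_integrand_eq hreal hy s
  have hSint : Integrable (fun y ↦ ∑' i, G i y) (volume.restrict (Ioi 1)) := by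
    refine (hIint.sub hHint).congr ?_
    filter_upwards [ae_restrict_mem measurableSet_Ioi] with y hy
    rw [Pi.sub_apply, hpt y hy]
    ring
  have hM' : Landau.mellinIoi g s = (∫ y in Ioi (1 : ℝ), ∑' i, G i y) + M / s := by
    rw [Landau.mellinIoi, ← hHval, ← integral_add hSint hHint]
    exact setIntegral_congr_fun measurableSet_Ioi hpt
  rw [hM', add_sub_cancel_right]
  exact key


/-- `s ↦ Σᵢ cᵢ/(s-λᵢ)` is holomorphic off the (closed) set of exponents (`M`-test on a small ball). [folklore] -/
theorem evenEngine_differentiableAt_fractions (hc : Summable fun i ↦ ‖c i‖)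
    (hlf : ∀ z : ℂ, ∃ ε > 0, {i | lam i ∈ ball z ε}.Finite) {z : ℂ} (hz : ∀ i, lam i ≠ z) :
    DifferentiableAt ℂ (fun s ↦ ∑' i, c i / (s - lam i)) z := by
  have hclosed : IsClosed (lam '' Set.univ) := BoundedPowerSum.isClosed_image hlf _
  have hzmem : z ∈ (lam '' Set.univ)ᶜ := by rintro ⟨i, -, hi⟩; exact hz i hi
  obtain ⟨δ, hδ, hball⟩ := Metric.isOpen_iff.1 hclosed.isOpen_compl z hzmem
  have hdist : ∀ s ∈ ball z (δ / 2), ∀ i, δ / 2 ≤ ‖s - lam i‖ := by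
    intro s hs i
    by_contra h
    push Not at h
    have hmem : lam i ∈ ball z δ := by
      rw [mem_ball] at hs ⊢
      calc dist (lam i) z ≤ dist (lam i) s + dist s z := dist_triangle _ _ _
        _ < δ / 2 + δ / 2 := add_lt_add (by rw [dist_comm, dist_eq_norm]; exact h) hs
        _ = δ := by ring
    exact hball hmem ⟨i, Set.mem_univ _, rfl⟩
  have hd : DifferentiableOn ℂ (fun s ↦ ∑' i, c i / (s - lam i)) (ball z (δ / 2)) := by
    refine differentiableOn_tsum_of_summable_norm (u := fun i ↦ ‖c i‖ * (2 / δ))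
      (hc.mul_right _) (fun i ↦ ?_) isOpen_ball fun i s hs ↦ ?_
    · refine DifferentiableOn.div (differentiableOn_const _) (by fun_prop) fun s hs h0 ↦ ?_
      have h := hdist s hs i
      rw [h0, norm_zero] at h
      linarith
    · rw [norm_div]
      have hsi := hdist s hs i
      have hpos : 0 < ‖s - lam i‖ := by linarith
      rw [div_le_iff₀ hpos]
      calc ‖c i‖ = ‖c i‖ * (2 / δ) * (δ / 2) := by field_simp
        _ ≤ ‖c i‖ * (2 / δ) * ‖s - lam i‖ := by gcongr
  exact hd.differentiableAt (isOpen_ball.mem_nhds (mem_ball_self (by positivity)))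


/-- **Engine, analytic half.**  For a real exponential sum `F(x) = Σᵢ cᵢ e^{λᵢ x}` (`Σ‖cᵢ‖ < ∞`,
`Re λᵢ ≤ R`, `0 ≤ R`, `(λᵢ)` locally finite, no `λᵢ` on the open positive real axis) with `F ≥ -M` on `x ≥ 0`
there is `𝓜` (the Landau–Mellin transform of `y ↦ F(log y) + M ≥ 0`) holomorphic on the WHOLE half-plane
`Re s > 0` with `HasSum (cᵢ/(s-λᵢ)) (𝓜 s - M/s)` for `Re s > R`: Landau's theorem (tree
`Landau.integrableOn_of_differentiableOn_union_convex`) with the continuation `Σᵢ cᵢ/(s-λᵢ) + M/s`, holomorphic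
on `{Re s > R+1} ∪ W₀`, `W₀ = {0 < Re s < R+3, |Im s| < η}` free of exponents. [folklore] -/
theorem stub_evenEngine_transform :
    ∀ (ι : Type) [Countable ι] (c lam : ι → ℂ) (R M : ℝ), 0 ≤ R →
      Summable (fun i => ‖c i‖) → (∀ i, (lam i).re ≤ R) →
      (∀ z : ℂ, ∃ ε > 0, {i | lam i ∈ Metric.ball z ε}.Finite) →
      (∀ i, 0 < (lam i).re → (lam i).im ≠ 0) →
      (∀ x : ℝ, 0 ≤ x → (∑' i, c i * cexp (lam i * x)).im = 0) →
      (∀ x : ℝ, 0 ≤ x → -M ≤ (∑' i, c i * cexp (lam i * x)).re) →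
      ∃ 𝓜 : ℂ → ℂ, DifferentiableOn ℂ 𝓜 {s : ℂ | 0 < s.re} ∧
        ∀ s : ℂ, R < s.re → HasSum (fun i => c i / (s - lam i)) (𝓜 s - M / s) := by
  intro ι _ c lam R M hR0 hc hR hlf hax hreal hM
  classical
  set g : ℝ → ℝ := fun y ↦ (∑' i, c i * cexp (lam i * ((Real.log (max y 1) : ℝ) : ℂ))).re + M with hg
  refine ⟨Landau.mellinIoi g, ?_, fun s hs ↦ evenEngine_hasSum_transform hc hR hR0 hreal hs⟩
  have hgm : Measurable g := (evenEngine_continuous_g hc hR hR0).measurable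
  set σ₁ : ℝ := R + 1 with hσ₁
  have hint := evenEngine_hint hc hR hR0 (M := M) (σ₁ := σ₁) (by rw [hσ₁]; linarith)
  -- finitely many exponents in the box `[0, σ₁+2] × [-1, 1]`; `η` below their ordinates
  set Kbox : Set ℂ := Icc (0 : ℝ) (σ₁ + 2) ×ℂ Icc (-1 : ℝ) 1 with hKbox
  have hKc : IsCompact Kbox := isCompact_Icc.reProdIm isCompact_Icc
  have hfin : {i | lam i ∈ Kbox}.Finite := BoundedPowerSum.finite_preimage_of_isCompact hlf hKc
  set S : Finset ι := hfin.toFinset.filter (fun i ↦ 0 < (lam i).re) with hS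
  set T : Finset ℝ := insert 1 (S.image fun i ↦ |(lam i).im|) with hT
  have hTne : T.Nonempty := Finset.insert_nonempty _ _
  set η : ℝ := T.min' hTne with hη
  have hη1 : η ≤ 1 := Finset.min'_le _ _ (Finset.mem_insert_self _ _)
  have hηpos : 0 < η := by
    rw [hη, Finset.lt_min'_iff]
    intro y hy
    rcases Finset.mem_insert.1 hy with rfl | hy
    · exact one_pos
    · obtain ⟨i, hi, rfl⟩ := Finset.mem_image.1 hy
      exact abs_pos.2 (hax i (Finset.mem_filter.1 hi).2)
  have hηle : ∀ i, 0 < (lam i).re → (lam i).re ≤ σ₁ + 2 → |(lam i).im| ≤ 1 → η ≤ |(lam i).im| := by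
    intro i h0 h1 h2
    apply Finset.min'_le
    refine Finset.mem_insert_of_mem (Finset.mem_image.2 ⟨i, ?_, rfl⟩)
    refine Finset.mem_filter.2 ⟨hfin.mem_toFinset.2 ?_, h0⟩
    show lam i ∈ Kbox
    rw [hKbox, Complex.mem_reProdIm]
    exact ⟨⟨h0.le, h1⟩, abs_le.1 h2⟩
  -- the box `W₀`
  set W₀ : Set ℂ := {s : ℂ | 0 < s.re} ∩ {s : ℂ | s.re < σ₁ + 2} ∩ {s : ℂ | s.im < η} ∩
    {s : ℂ | -η < s.im} with hW₀
  have hW₀o : IsOpen W₀ :=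
    (((isOpen_lt continuous_const Complex.continuous_re).inter
      (isOpen_lt Complex.continuous_re continuous_const)).inter
      (isOpen_lt Complex.continuous_im continuous_const)).inter
      (isOpen_lt continuous_const Complex.continuous_im)
  have hW₀c : Convex ℝ W₀ :=
    (((convex_halfSpace_re_gt 0).inter (convex_halfSpace_re_lt _)).inter
      (convex_halfSpace_im_lt _)).inter (convex_halfSpace_im_gt _)
  have hW₀r : ∀ σ : ℝ, 0 < σ → σ ≤ σ₁ + 1 → (σ : ℂ) ∈ W₀ := by
    intro σ h0 h1
    simp only [hW₀, Set.mem_inter_iff, Set.mem_setOf_eq, ofReal_re, ofReal_im]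
    exact ⟨⟨⟨h0, by linarith⟩, hηpos⟩, by linarith⟩
  -- no pole of the continuation on `{Re s > σ₁} ∪ W₀`
  have hgood : ∀ s ∈ ({s : ℂ | σ₁ < s.re} ∪ W₀), s ≠ 0 ∧ ∀ i, lam i ≠ s := by
    intro s hs
    rcases hs with hs | hs
    · simp only [Set.mem_setOf_eq] at hs
      refine ⟨fun h ↦ ?_, fun i h ↦ ?_⟩
      · rw [h, zero_re] at hs; linarith
      · have := hR i; rw [h] at this; linarith
    · simp only [hW₀, Set.mem_inter_iff, Set.mem_setOf_eq] at hs
      obtain ⟨⟨⟨h0, h1⟩, h2⟩, h3⟩ := hs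
      refine ⟨fun h ↦ ?_, fun i h ↦ ?_⟩
      · rw [h, zero_re] at h0; exact lt_irrefl _ h0
      · rw [← h] at h0 h1 h2 h3
        have habs : |(lam i).im| < η := abs_lt.2 ⟨h3, h2⟩
        have := hηle i h0 h1.le (habs.le.trans hη1)
        linarith
  -- the continuation `Φ` and its holomorphy
  set Φ : ℂ → ℂ := fun s ↦ (∑' i, c i / (s - lam i)) + M / s with hΦ
  have hΦd : DifferentiableOn ℂ Φ ({s : ℂ | σ₁ < s.re} ∪ W₀) := by
    intro s hs
    obtain ⟨hs0, hsi⟩ := hgood s hs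
    exact ((evenEngine_differentiableAt_fractions hc hlf hsi).add
      ((differentiableAt_const _).div differentiableAt_id hs0)).differentiableWithinAt
  have hagree : EqOn Φ (Landau.mellinIoi g) {s : ℂ | σ₁ < s.re} := by
    intro s hs
    have hs' : R < s.re := by simp only [Set.mem_setOf_eq] at hs; linarith
    have h := (evenEngine_hasSum_transform hc hR hR0 hreal hs' (M := M)).tsum_eq
    simp only [hΦ]
    rw [h]
    ring
  -- Landau's theorem: absolute convergence, hence holomorphy, on `Re s > 0`
  have hconv : ∀ σ : ℝ, 0 < σ → IntegrableOn (fun y ↦ g y * y ^ (-(σ + 1))) (Ioi 1) := fun σ hσ ↦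
    Landau.integrableOn_of_differentiableOn_union_convex hgm hint le_rfl
      (fun y _ ↦ evenEngine_g_nonneg hM y) (by rw [hσ₁]; linarith) hW₀o hW₀c hW₀r hΦd hagree hσ
  exact Landau.differentiableOn_mellinIoi_of_forall hgm hconv

end Transform

end Summit.RiemannHypothesis.RiemannHypothesis.Theorems.RuelleBandExactFirstBand

end
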